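import Literature.Analysis.FluidPDE.BourgainPavlovicData
import Literature.Analysis.FluidPDE.NSFourierSobolev
import Literature.Analysis.FluidPDE.TaoAveragedEuler
import Literature.Analysis.FluidPDE.CriticalSpaces
import Literature.Analysis.FunctionSpaces.LittlewoodPaleyBernsteinProofs
import Literature.Analysis.FunctionSpaces.LittlewoodPaleySquareFunction
import Mathlib.Analysis.Distribution.FourierMultiplier
import HarnessLib

/-!
# The Bourgain–Pavlović datum is a Schwartz field, small in `Ḃ^{-1}_{∞,∞}`

Third support file for the discharge of the barrier
`Literature.Barriers.NavierStokesRegularity.CriticalBesovNormInflation` (Bourgain–Pavlović 2008,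
Thm. 1.1). The physical datum is the synthesis `u₀ = synthVel a₀ = Re 𝓕 a₀` of the Fourier-side
datum `a₀ = InflationParams.datum` of `BourgainPavlovicData` (smooth, compactly supported,
conjugation symmetric). (As recorded in the review of `BourgainPavlovicData`: the polarisations
`p(k_s) ∥ e₀ = η`, `q(k'_s) ∥ e₂` deliberately depart from Bourgain–Pavlović's (3.3),
`η·v_s = η·v'_s = 1/2`, and the factor `i` turns their cosines into sines — a variant with the same
mechanism, the low-frequency interaction `(v_s·η) v'_s + (v'_s·η) v_s = e₂ ⊥ η` being nonzero; the
barrier fact is existential in the datum, so constants are never compared with BP's `1/2`-factors.)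
Here we establish the four properties of `u₀` that the barrier statement asks of the datum,
entirely through Mathlib's Schwartz-space calculus:

* `u₀` **is a Schwartz field** (`isSchwartzField_synthVel`): `a₀` is a Schwartz map
  (`HasCompactSupport.toSchwartzMap`), hence so is its Fourier transform `𝓕 a₀`
  (`SchwartzMap.instFourierTransform`), which is real-valued by the conjugation symmetry and whose
  real part, `u₀`, is therefore a Schwartz map (`SchwartzMap.postcompCLM`);
* `u₀` **is divergence free** (`isDivFree_synthVel`; the tree's `FourierDatum.isDivFree_u` at
  `t = 0`);
* the Schwartz function `𝓕 a₀ ∈ 𝓢(ℝ³, ℂ³)` **is the tempered distribution of `u₀`**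
  (`isDistributionOf_synthVel`, in the sense of the accepted `IsDistributionOf`);
* **smallness in the largest critical space**: every Littlewood–Paley block of that distribution
  is the Schwartz function `𝓕⁻(φ_j · (a₀ ∘ neg))`
  (`TemperedDistribution.fourierMultiplierCLM_toTemperedDistributionCLM_eq`), bounded pointwise by
  `∫ |φ_j| ‖a₀‖`; on the dyadic shell of `φ_j` only the scales `N_s < 2^{j+1} + 2` are present and
  their lacunary sum is `≤ 4 · 2^j`, whence
  `sup_j 2^{-j} ‖Δ̇_j u₀‖_{L^∞} ≤ 96 α m`, `m = ∫ ψ` (`eHomBesovNorm_datum_le`): Bourgain–Pavlović's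
  `‖u₀‖_{Ḃ^{-1,∞}_∞} ∼ Q/√r` ((3.3) of their §3.1, with `α = Q/√r`).

## References

* J. Bourgain, N. Pavlović, *Ill-posedness of the Navier–Stokes equations in a critical space in
  3D*, J. Funct. Anal. 255 (2008), §3.1, (3.1)–(3.3). [BourgainPavlovic2008]
* H. Bahouri, J.-Y. Chemin, R. Danchin, *Fourier Analysis and Nonlinear PDE*, Springer 2011,
  Prop. 2.10 (support of the dyadic symbols). [BahouriCheminDanchin2011]
-/

noncomputable section

open MeasureTheory Real Set Filter Topology Function Complex SchwartzMap FourierTransform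
open scoped ComplexConjugate ContDiff FourierTransform RealInnerProductSpace ENNReal

namespace Literature.Analysis.FluidPDE.BourgainPavlovic

open FourierNS Literature.Analysis.FunctionSpaces

/-- Local notation for physical / frequency space `ℝ³`. -/
local notation "E3" => EuclideanSpace ℝ (Fin 3)
/-- Local notation for the complexified value space `ℂ³`. -/
local notation "C3" => EuclideanSpace ℂ (Fin 3)

/-! ### Two small Fourier-side tools -/

/-- **A continuous linear map passes through the Fourier integral**: `L (𝓕 f x) = 𝓕 (L ∘ f) x`
for integrable `f`. [folklore] -/
theorem clm_apply_fourier_eq {F G : Type*} [NormedAddCommGroup F] [NormedSpace ℂ F]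
    [NormedAddCommGroup G] [NormedSpace ℂ G] [CompleteSpace F] [CompleteSpace G]
    (L : F →L[ℂ] G) {f : E3 → F} (hf : Integrable f) (x : E3) :
    L (𝓕 f x) = 𝓕 (fun v => L (f v)) x := by
  rw [Real.fourier_eq, Real.fourier_eq, ← L.integral_comp_comm]
  · refine integral_congr_ae (Eventually.of_forall fun v => ?_)
    simp only [Circle.smul_def, map_smul]
  · exact (Real.fourierIntegral_convergent_iff x).2 hf

/-- **Components of a vector Fourier integral**: `(𝓕 f x) l = 𝓕 (fun v => f v l) x` for
integrable `f : ℝ³ → ℂ³`. [folklore] -/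
theorem fourier_apply_coord {f : E3 → C3} (hf : Integrable f) (x : E3) (l : Fin 3) :
    (𝓕 f x) l = 𝓕 (fun v => f v l) x :=
  clm_apply_fourier_eq (EuclideanSpace.proj l) hf x

namespace InflationParams

variable (d : InflationParams)

/-! ### The datum as a Schwartz map -/

/-- The datum as a `ℂ³`-valued function, `a₀ᶜ(ξ) = (a₀(ξ)_l)_l ∈ ℂ³`. [folklore] -/
def datumC (ξ : E3) : C3 := WithLp.toLp 2 (d.datum ξ)

/-- Components of `datumC`. [folklore] -/
@[simp]
theorem datumC_apply (ξ : E3) (l : Fin 3) : d.datumC ξ l = d.datum ξ l := rfl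

/-- `datumC` is smooth. [folklore] -/
theorem contDiff_datumC : ContDiff ℝ ∞ d.datumC :=
  (contDiff_piLp (𝕜 := ℝ) 2 (f := d.datumC)).2 fun l => d.contDiff_datum_apply l

/-- `datumC` is continuous. [folklore] -/
theorem continuous_datumC : Continuous d.datumC := d.contDiff_datumC.continuous

/-- `datumC` vanishes outside the ball of radius `N_{r-1} + 2`. [folklore] -/
theorem datumC_eq_zero_of_le {ξ : E3} (h : d.suppRadius ≤ ‖ξ‖) : d.datumC ξ = 0 := by
  ext l
  rw [datumC_apply, d.datum_eq_zero_of_le h]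
  rfl

/-- `datumC` has compact support. [folklore] -/
theorem hasCompactSupport_datumC : HasCompactSupport d.datumC := by
  refine HasCompactSupport.intro (isCompact_closedBall (0 : E3) d.suppRadius) fun ξ hξ => ?_
  apply d.datumC_eq_zero_of_le
  rw [Metric.mem_closedBall, dist_zero_right, not_le] at hξ
  exact hξ.le

/-- Pointwise size of `datumC`: `‖a₀ᶜ(ξ)‖ ≤ ∑ₗ |a₀(ξ)_l|` (Euclidean norm against the sum of the
moduli of the coordinates). [folklore] -/
theorem norm_datumC_le_sum (ξ : E3) : ‖d.datumC ξ‖ ≤ ∑ l, ‖d.datum ξ l‖ := by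
  rw [EuclideanSpace.norm_eq]
  have h : ∑ l, ‖d.datumC ξ l‖ ^ 2 ≤ (∑ l, ‖d.datum ξ l‖) ^ 2 := by
    simp only [datumC_apply]
    rw [sq, Finset.sum_mul_sum]
    refine Finset.sum_le_sum fun l _ => ?_
    rw [sq]
    exact Finset.single_le_sum (f := fun j => ‖d.datum ξ l‖ * ‖d.datum ξ j‖)
      (fun j _ => mul_nonneg (norm_nonneg _) (norm_nonneg _)) (Finset.mem_univ l)
  calc Real.sqrt (∑ l, ‖d.datumC ξ l‖ ^ 2) ≤ Real.sqrt ((∑ l, ‖d.datum ξ l‖) ^ 2) :=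
        Real.sqrt_le_sqrt h
    _ = ∑ l, ‖d.datum ξ l‖ := Real.sqrt_sq (Finset.sum_nonneg fun l _ => norm_nonneg _)

/-- **The Fourier-side datum as a Schwartz map** `a₀ ∈ 𝓢(ℝ³, ℂ³)` (smooth with compact support). [folklore] -/
def datumSchwartz : 𝓢(E3, C3) := d.hasCompactSupport_datumC.toSchwartzMap d.contDiff_datumC

/-- The Schwartz map is the datum. [folklore] -/
@[simp]
theorem datumSchwartz_apply (ξ : E3) : d.datumSchwartz ξ = d.datumC ξ := rfl

/-! ### The synthesis as a Schwartz map -/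

/-- **The complex synthesis of the datum as a Schwartz map**: `𝓕 a₀ ∈ 𝓢(ℝ³, ℂ³)`. [folklore] -/
def synthSchwartz : 𝓢(E3, C3) := 𝓕 d.datumSchwartz

/-- The synthesis is the Fourier integral of `datumC`. [folklore] -/
theorem synthSchwartz_apply (x : E3) : d.synthSchwartz x = 𝓕 d.datumC x := by
  rw [synthSchwartz, SchwartzMap.fourier_coe]
  rfl

/-- Components of the synthesis: `(𝓕 a₀)(x)_l = 𝓕 (a₀)_l (x)`. [folklore] -/
theorem synthSchwartz_apply_apply (x : E3) (l : Fin 3) :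
    d.synthSchwartz x l = 𝓕 (fun ξ => d.datum ξ l) x := by
  have hint : Integrable d.datumC volume := d.datumSchwartz.integrable
  rw [synthSchwartz_apply, fourier_apply_coord hint x l]
  rfl

/-- **The synthesis is real** and its real part is the physical datum:
`(u₀(x)_l : ℂ) = (𝓕 a₀)(x)_l` with `u₀ = synthVel a₀` (conjugation symmetry of `a₀`; the tree's
`FourierDatum.ofReal_u_apply` at `t = 0`). [folklore] -/
theorem ofReal_synthVel_apply (x : E3) (l : Fin 3) :
    ((synthVel d.datum x l : ℝ) : ℂ) = d.synthSchwartz x l := by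
  have hv0 : d.fourierDatum.v 0 = d.datum := funext fun ξ => d.fourierDatum.v_zero ξ
  have h := d.fourierDatum.ofReal_u_apply 0 x l
  simp only [FourierDatum.u_eq_synthVel, FourierDatum.U, hv0] at h
  rw [synthSchwartz_apply_apply]
  exact h

/-- The complexification of the physical datum is the synthesis:
`complexify (u₀ x) = (𝓕 a₀)(x)`. [folklore] -/
theorem complexify_synthVel (x : E3) :
    FunctionSpaces.EuclideanSpace.complexify (synthVel d.datum x) = d.synthSchwartz x := by
  ext l
  rw [FunctionSpaces.EuclideanSpace.complexify_apply, ofReal_synthVel_apply]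

/-- The coordinatewise real part `ℂ³ →L[ℝ] ℝ³`. [folklore] -/
def reVecE : C3 →L[ℝ] E3 :=
  (EuclideanSpace.equiv (Fin 3) ℝ).symm.toContinuousLinearMap.comp
    (ContinuousLinearMap.pi fun l => Complex.reCLM.comp (EuclideanSpace.proj (𝕜 := ℂ) l |>.restrictScalars ℝ))

/-- Components of `reVecE`. [folklore] -/
@[simp]
theorem reVecE_apply (z : C3) (l : Fin 3) : reVecE z l = (z l).re := rfl

/-- **The physical datum as a Schwartz map**: `u₀ = Re ∘ 𝓕 a₀ ∈ 𝓢(ℝ³, ℝ³)`. [folklore] -/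
def velSchwartz : 𝓢(E3, E3) := d.synthSchwartz.postcompCLM reVecE

/-- The physical Schwartz map is `synthVel a₀`. [folklore] -/
theorem velSchwartz_apply (x : E3) : d.velSchwartz x = synthVel d.datum x := by
  ext l
  rw [velSchwartz, SchwartzMap.postcompCLM_apply, reVecE_apply, ← ofReal_synthVel_apply,
    Complex.ofReal_re]

/-- **The Bourgain–Pavlović datum is a Schwartz field** (`u(0) ∈ 𝒮`, as Thm. 1.1 of
Bourgain–Pavlović 2008 asserts). [cite: BourgainPavlovic2008, Thm. 1.1 ("u(0) ∈ 𝒮")] -/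
theorem isSchwartzField_synthVel : IsSchwartzField (synthVel d.datum) :=
  ⟨d.velSchwartz, funext d.velSchwartz_apply⟩

/-- **The datum is divergence free** (pointwise; `∑ₗ ξₗ a₀(ξ)_l = 0` on the Fourier side, the
tree's `FourierDatum.isDivFree_u` at `t = 0`). [cite: BourgainPavlovic2008, §3.1 ("div u₀ = 0")] -/
theorem isDivFree_synthVel : VectorCalculus.IsDivFree (synthVel d.datum) := by
  have h := d.fourierDatum.isDivFree_u 0
  have hv : d.fourierDatum.v 0 = d.datum := funext fun ξ => d.fourierDatum.v_zero ξ
  rwa [FourierDatum.u_eq_synthVel, hv] at h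

/-- The physical datum is continuous. [folklore] -/
theorem continuous_synthVel : Continuous (synthVel d.datum) := by
  rw [← funext d.velSchwartz_apply]
  exact d.velSchwartz.continuous

/-- The physical datum is bounded: `‖u₀(x)‖ ≤ ∫ ‖a₀ᶜ‖`. [folklore] -/
theorem norm_synthVel_le (x : E3) : ‖synthVel d.datum x‖ ≤ ∫ ξ, ‖d.datumC ξ‖ := by
  calc ‖synthVel d.datum x‖ = ‖FunctionSpaces.EuclideanSpace.complexify (synthVel d.datum x)‖ :=
        (FunctionSpaces.EuclideanSpace.norm_complexify _).symm
    _ = ‖𝓕 d.datumC x‖ := by rw [complexify_synthVel, synthSchwartz_apply]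
    _ ≤ ∫ ξ, ‖d.datumC ξ‖ := VectorFourier.norm_fourierIntegral_le_integral_norm _ _ _ _ _

/-- The physical datum is essentially bounded. [folklore] -/
theorem memLp_top_synthVel : MemLp (synthVel d.datum) ∞ volume :=
  memLp_top_of_bound d.continuous_synthVel.aestronglyMeasurable _
    (Eventually.of_forall d.norm_synthVel_le)

/-! ### The tempered distribution of the datum -/

/-- **The tempered distribution of the datum**: the Schwartz function `𝓕 a₀ ∈ 𝓢(ℝ³, ℂ³)` seen
in `𝓢'(ℝ³, ℂ³)`. [folklore] -/
def datumDistrib : 𝓢'(E3, C3) := (d.synthSchwartz : 𝓢'(E3, C3))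

/-- **`𝓕 a₀` is the tempered distribution of `u₀ = synthVel a₀`** in the sense of the accepted
`IsDistributionOf` (integration of the complexified field against Schwartz tests). [folklore] -/
theorem isDistributionOf_synthVel : IsDistributionOf (synthVel d.datum) d.datumDistrib := by
  intro φ
  have he : (fun x => φ x • FunctionSpaces.EuclideanSpace.complexify (synthVel d.datum x)) =
      fun x => φ x • d.synthSchwartz x := by
    funext x; rw [complexify_synthVel]
  rw [he]
  refine ⟨?_, ?_⟩
  · -- `φ • 𝓕 a₀` is integrable: `φ` is bounded and `𝓕 a₀` is integrable
    obtain ⟨C, -, hC⟩ := φ.decay 0 0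
    have hC' : ∀ x, ‖φ x‖ ≤ C := fun x => by simpa using hC x
    refine (d.synthSchwartz.integrable.norm.const_mul C).mono'
      (φ.continuous.aestronglyMeasurable.smul d.synthSchwartz.continuous.aestronglyMeasurable)
      (Eventually.of_forall fun x => ?_)
    rw [norm_smul]
    exact mul_le_mul_of_nonneg_right (hC' x) (norm_nonneg _)
  · rw [datumDistrib, SchwartzMap.coe_apply]

/-! ### Lacunary sums of the scales -/

/-- **Lacunary partial sums**: `∑_{s ≤ s₀} N_s ≤ (8/7) N_{s₀}` (ratio `≥ 8`). [folklore] -/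
theorem sum_N_le (s₀ : ℕ) : ∑ s ∈ Finset.range (s₀ + 1), d.N s ≤ 8 / 7 * d.N s₀ := by
  induction s₀ with
  | zero => simp; linarith [d.N_pos 0]
  | succ k ih =>
    rw [Finset.sum_range_succ]
    have h8 := d.eight_mul_N_le k
    linarith

/-- **The scales below a dyadic threshold have a lacunary sum**: for every `j ∈ ℤ`,
`∑_{s < r, N_s < 2^{j+1} + 2} (N_s + 2) ≤ 4 · 2^j` (empty unless `2^{j+1} ≥ 8`; then the largest
such scale dominates geometrically). [folklore] -/
theorem sum_filter_N_add_two_le (j : ℤ) :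
    ∑ s ∈ (Finset.range d.r).filter (fun s => d.N s < (2 : ℝ) ^ (j + 1) + 2), (d.N s + 2) ≤
      4 * (2 : ℝ) ^ j := by
  set F := (Finset.range d.r).filter (fun s => d.N s < (2 : ℝ) ^ (j + 1) + 2) with hF
  have h2j : 0 < (2 : ℝ) ^ j := zpow_pos two_pos j
  rcases F.eq_empty_or_nonempty with hE | hne
  · rw [hE, Finset.sum_empty]; positivity
  · -- the largest scale in `F`
    set s₀ := F.max' hne with hs₀
    have hs₀F : s₀ ∈ F := F.max'_mem hne
    have hs₀N : d.N s₀ < (2 : ℝ) ^ (j + 1) + 2 := (Finset.mem_filter.1 hs₀F).2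
    have hsub : F ⊆ Finset.range (s₀ + 1) := fun s hs =>
      Finset.mem_range.2 (Nat.lt_succ_of_le (F.le_max' s hs))
    -- `2^{j+1} ≥ 8`, since `N_{s₀} ≥ 8`
    have h8 : (8 : ℝ) ≤ (2 : ℝ) ^ (j + 1) := by
      by_contra hlt
      push Not at hlt
      have hle : j + 1 ≤ 2 := by
        by_contra hgt
        push Not at hgt
        have : (2 : ℝ) ^ (3 : ℤ) ≤ (2 : ℝ) ^ (j + 1) := zpow_le_zpow_right₀ one_le_two (by omega)
        norm_num at this
        linarith
      have : (2 : ℝ) ^ (j + 1) ≤ (2 : ℝ) ^ (2 : ℤ) := zpow_le_zpow_right₀ one_le_two hle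
      norm_num at this
      linarith [d.eight_le_N s₀]
    calc ∑ s ∈ F, (d.N s + 2) ≤ ∑ s ∈ Finset.range (s₀ + 1), (d.N s + 2) :=
          Finset.sum_le_sum_of_subset_of_nonneg hsub fun s _ _ => by linarith [d.N_pos s]
      _ ≤ ∑ s ∈ Finset.range (s₀ + 1), (5 / 4) * d.N s := by
          refine Finset.sum_le_sum fun s _ => ?_
          linarith [d.eight_le_N s]
      _ = (5 / 4) * ∑ s ∈ Finset.range (s₀ + 1), d.N s := by rw [Finset.mul_sum]
      _ ≤ (5 / 4) * (8 / 7 * d.N s₀) := by gcongr; exact d.sum_N_le s₀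
      _ ≤ (5 / 4) * (8 / 7 * ((2 : ℝ) ^ (j + 1) + 2)) := by gcongr
      _ ≤ 4 * (2 : ℝ) ^ j := by
          rw [zpow_add_one₀ two_ne_zero] at h8 ⊢
          nlinarith

/-! ### The Littlewood–Paley blocks of the datum -/

/-- The mass `m = ∫ ψ` of the bump. [folklore] -/
def bumpMass : ℝ := ∫ ξ, d.ψ ξ

/-- `0 ≤ m`. [folklore] -/
theorem bumpMass_nonneg : 0 ≤ d.bumpMass := integral_nonneg d.ψ_nonneg

/-- `ψ` is integrable. [folklore] -/
theorem integrable_ψ : Integrable d.ψ := d.bump.integrable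

/-- `∫ B_s = 2m`. [folklore] -/
theorem integral_bumpK (s : ℕ) : ∫ ξ, d.bumpK s ξ = 2 * d.bumpMass := by
  simp only [bumpK]
  rw [integral_add (d.integrable_ψ.comp_sub_right _) (d.integrable_ψ.comp_add_right _),
    integral_sub_right_eq_self d.ψ, integral_add_right_eq_self d.ψ, bumpMass, two_mul]

/-- `∫ B'_s = 2m`. [folklore] -/
theorem integral_bumpK' (s : ℕ) : ∫ ξ, d.bumpK' s ξ = 2 * d.bumpMass := by
  simp only [bumpK']
  rw [integral_add (d.integrable_ψ.comp_sub_right _) (d.integrable_ψ.comp_add_right _),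
    integral_sub_right_eq_self d.ψ, integral_add_right_eq_self d.ψ, bumpMass, two_mul]

/-- `B_s` is integrable. [folklore] -/
theorem integrable_bumpK (s : ℕ) : Integrable (d.bumpK s) :=
  (d.integrable_ψ.comp_sub_right _).add (d.integrable_ψ.comp_add_right _)

/-- `B'_s` is integrable. [folklore] -/
theorem integrable_bumpK' (s : ℕ) : Integrable (d.bumpK' s) :=
  (d.integrable_ψ.comp_sub_right _).add (d.integrable_ψ.comp_add_right _)

/-- **The majorant of the `j`-th block's symbol**: on the shell of `φ_j` only the scales with
`N_s < 2^{j+1} + 2` are present, each contributing at most `α (B_s + B'_s)(N_s + 2)` per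
coordinate; summing the three coordinates and the symbol bound `‖φ_j‖ ≤ 2` gives
`G_j(ξ) = 6 ∑_{s<r, N_s<2^{j+1}+2} α (B_s(ξ) + B'_s(ξ)) (N_s + 2)`. [folklore] -/
def blockMajorant (j : ℤ) (ξ : E3) : ℝ :=
  6 * ∑ s ∈ (Finset.range d.r).filter (fun s => d.N s < (2 : ℝ) ^ (j + 1) + 2),
    d.α * ((d.bumpK s ξ + d.bumpK' s ξ) * (d.N s + 2))

/-- The summands of the majorant are integrable. [folklore] -/
theorem integrable_majorantTerm (s : ℕ) (c : ℝ) :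
    Integrable fun ξ : E3 => d.α * ((d.bumpK s ξ + d.bumpK' s ξ) * c) :=
  (((d.integrable_bumpK s).add (d.integrable_bumpK' s)).mul_const c).const_mul d.α

/-- The majorant is integrable. [folklore] -/
theorem integrable_blockMajorant (j : ℤ) : Integrable (d.blockMajorant j) :=
  Integrable.const_mul (integrable_finsetSum _ fun s _ => d.integrable_majorantTerm s _) _

/-- **The integral of the majorant**: `∫ G_j = 24 α m ∑_{s<r, N_s<2^{j+1}+2} (N_s + 2) ≤ 96 α m 2^j`. [folklore] -/
theorem integral_blockMajorant_le (j : ℤ) :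
    ∫ ξ, d.blockMajorant j ξ ≤ 96 * d.α * d.bumpMass * (2 : ℝ) ^ j := by
  have hα := d.α_pos.le
  have hm := d.bumpMass_nonneg
  have hterm : ∀ s, ∫ ξ, d.α * ((d.bumpK s ξ + d.bumpK' s ξ) * (d.N s + 2)) =
      d.α * (4 * d.bumpMass * (d.N s + 2)) := fun s => by
    rw [integral_const_mul, integral_mul_const, integral_add (d.integrable_bumpK s)
      (d.integrable_bumpK' s), integral_bumpK, integral_bumpK']
    ring
  simp only [blockMajorant]
  rw [integral_const_mul, integral_finsetSum _ (fun s _ => d.integrable_majorantTerm s _)]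
  simp only [hterm, ← Finset.mul_sum]
  have hsum := d.sum_filter_N_add_two_le j
  calc 6 * (d.α * (4 * d.bumpMass *
        ∑ s ∈ (Finset.range d.r).filter (fun s => d.N s < (2 : ℝ) ^ (j + 1) + 2), (d.N s + 2)))
      ≤ 6 * (d.α * (4 * d.bumpMass * (4 * (2 : ℝ) ^ j))) := by gcongr
    _ = 96 * d.α * d.bumpMass * (2 : ℝ) ^ j := by ring

/-- Where `φ_j(ξ) ≠ 0` the frequency lies in the open shell `2^{j-1} < ‖ξ‖ < 2^{j+1}`
(BCD Prop. 2.10, the tree's discharged support facts). [cite: BahouriCheminDanchin2011, Prop. 2.10] -/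
theorem shell_of_dyadicSymbol_ne_zero {j : ℤ} {ξ : E3} (h : dyadicSymbol j ξ ≠ 0) :
    (2 : ℝ) ^ (j - 1) < ‖ξ‖ ∧ ‖ξ‖ < (2 : ℝ) ^ (j + 1) := by
  constructor
  · by_contra hc
    exact h (dyadicSymbol_apply_of_norm_le_holds (not_lt.1 hc))
  · by_contra hc
    exact h (dyadicSymbol_apply_of_le_norm_holds (not_lt.1 hc))

/-- **Pointwise domination of the block's symbol by the majorant**:
`‖φ_j(ξ)‖ ‖a₀ᶜ(-ξ)‖ ≤ G_j(ξ)`. [folklore] -/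
theorem norm_dyadicSymbol_mul_norm_datumC_neg_le (j : ℤ) (ξ : E3) :
    ‖dyadicSymbol j ξ‖ * ‖d.datumC (-ξ)‖ ≤ d.blockMajorant j ξ := by
  have hα := d.α_pos.le
  by_cases hφ : dyadicSymbol j ξ = 0
  · rw [hφ, norm_zero, zero_mul, blockMajorant]
    refine mul_nonneg (by norm_num) (Finset.sum_nonneg fun s _ => mul_nonneg hα
      (mul_nonneg (add_nonneg (d.bumpK_nonneg s ξ) (d.bumpK'_nonneg s ξ)) ?_))
    linarith [d.N_pos s]
  · have hshell := shell_of_dyadicSymbol_ne_zero hφ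
    -- each coordinate: only the scales `N_s < 2^{j+1} + 2` survive
    have hcoord : ∀ l, ‖d.datum (-ξ) l‖ ≤
        ∑ s ∈ (Finset.range d.r).filter (fun s => d.N s < (2 : ℝ) ^ (j + 1) + 2),
          d.α * ((d.bumpK s ξ + d.bumpK' s ξ) * (d.N s + 2)) := by
      intro l
      rw [d.datum_apply, norm_mul, Complex.norm_I, one_mul]
      calc ‖∑ s ∈ Finset.range d.r, (d.piece s (-ξ) l : ℂ)‖
          ≤ ∑ s ∈ Finset.range d.r, ‖(d.piece s (-ξ) l : ℂ)‖ := norm_sum_le _ _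
        _ = ∑ s ∈ Finset.range d.r, |d.piece s (-ξ) l| := by
            simp only [Complex.norm_real, Real.norm_eq_abs]
        _ = ∑ s ∈ (Finset.range d.r).filter (fun s => d.N s < (2 : ℝ) ^ (j + 1) + 2),
              |d.piece s (-ξ) l| := by
            rw [Finset.sum_filter]
            refine Finset.sum_congr rfl fun s _ => ?_
            split_ifs with hs
            · rfl
            · rw [d.piece_eq_zero (Or.inl ?_) l, abs_zero]
              rw [norm_neg]
              push Not at hs
              linarith [hshell.2]
        _ ≤ _ := by
            refine Finset.sum_le_sum fun s _ => ?_
            have h := d.abs_piece_le s (-ξ) l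
            rwa [bumpK_neg, bumpK'_neg] at h
    calc ‖dyadicSymbol j ξ‖ * ‖d.datumC (-ξ)‖
        ≤ 2 * ∑ l, ‖d.datum (-ξ) l‖ :=
          mul_le_mul (norm_dyadicSymbol_le_two j ξ) (d.norm_datumC_le_sum (-ξ)) (norm_nonneg _)
            zero_le_two
      _ ≤ 2 * ∑ _l : Fin 3, ∑ s ∈ (Finset.range d.r).filter
            (fun s => d.N s < (2 : ℝ) ^ (j + 1) + 2),
            d.α * ((d.bumpK s ξ + d.bumpK' s ξ) * (d.N s + 2)) := by
          gcongr with l; exact hcoord l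
      _ = d.blockMajorant j ξ := by
          rw [Finset.sum_const, Finset.card_univ, Fintype.card_fin, nsmul_eq_mul, blockMajorant]
          ring

/-- **The Fourier transform of the synthesis is the reflected datum**:
`(𝓕 (𝓕 a₀))(ξ) = a₀ᶜ(-ξ)` (Fourier inversion on the Schwartz space). [folklore] -/
theorem fourier_synthSchwartz_apply (ξ : E3) : (𝓕 d.synthSchwartz) ξ = d.datumC (-ξ) := by
  have h1 : ((𝓕 d.synthSchwartz : 𝓢(E3, C3)) : E3 → C3) ξ =
      𝓕 (d.synthSchwartz : E3 → C3) ξ := by rw [SchwartzMap.fourier_coe]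
  have h2 : 𝓕 (d.synthSchwartz : E3 → C3) ξ = 𝓕⁻ (d.synthSchwartz : E3 → C3) (-ξ) := by
    rw [Real.fourierInv_eq_fourier_neg, neg_neg]
  have h3 : 𝓕⁻ (d.synthSchwartz : E3 → C3) (-ξ) = ((𝓕⁻ d.synthSchwartz : 𝓢(E3, C3)) : E3 → C3) (-ξ) := by
    rw [SchwartzMap.fourierInv_coe]
  rw [h1, h2, h3, synthSchwartz, FourierTransform.fourierInv_fourier_eq]
  rfl

/-- **The `j`-th Littlewood–Paley block of the datum as a Schwartz function**:
`W_j = 𝓕⁻(φ_j · 𝓕(𝓕 a₀)) ∈ 𝓢(ℝ³, ℂ³)`. [folklore] -/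
def blockSchwartz (j : ℤ) : 𝓢(E3, C3) :=
  SchwartzMap.fourierMultiplierCLM C3 (dyadicSymbol j) d.synthSchwartz

/-- **The block of the datum's distribution is the Schwartz block**:
`Δ̇_j (𝓕 a₀) = W_j` in `𝓢'` (Mathlib: the Fourier multiplier on `𝓢'` extends the one on `𝓢`). [folklore] -/
theorem lpBlock_datumDistrib (j : ℤ) :
    lpBlock j d.datumDistrib = ((d.blockSchwartz j : 𝓢(E3, C3)) : 𝓢'(E3, C3)) := by
  rw [lpBlock_apply, datumDistrib, blockSchwartz]
  exact TemperedDistribution.fourierMultiplierCLM_toTemperedDistributionCLM_eq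
    (hasTemperateGrowth_dyadicSymbol j) d.synthSchwartz

/-- **Pointwise bound on the Schwartz block**: `‖W_j(x)‖ ≤ ∫ G_j ≤ 96 α m 2^j`. [folklore] -/
theorem norm_blockSchwartz_le (j : ℤ) (x : E3) :
    ‖d.blockSchwartz j x‖ ≤ 96 * d.α * d.bumpMass * (2 : ℝ) ^ j := by
  set h : 𝓢(E3, C3) := SchwartzMap.smulLeftCLM C3 (dyadicSymbol (E := E3) j) (𝓕 d.synthSchwartz)
    with hh
  have happ : ∀ ξ, h ξ = dyadicSymbol j ξ • d.datumC (-ξ) := fun ξ => by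
    rw [hh, SchwartzMap.smulLeftCLM_apply_apply (hasTemperateGrowth_dyadicSymbol j),
      fourier_synthSchwartz_apply]
  have hW : d.blockSchwartz j x = 𝓕⁻ (h : E3 → C3) x := by
    rw [blockSchwartz, SchwartzMap.fourierMultiplierCLM_apply, ← hh, SchwartzMap.fourierInv_coe]
  calc ‖d.blockSchwartz j x‖ = ‖𝓕 (h : E3 → C3) (-x)‖ := by
        rw [hW, Real.fourierInv_eq_fourier_neg]
    _ ≤ ∫ ξ, ‖h ξ‖ := VectorFourier.norm_fourierIntegral_le_integral_norm _ _ _ _ _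
    _ ≤ ∫ ξ, d.blockMajorant j ξ := by
        refine integral_mono h.integrable.norm (d.integrable_blockMajorant j) fun ξ => ?_
        simp only [happ, norm_smul]
        exact d.norm_dyadicSymbol_mul_norm_datumC_neg_le j ξ
    _ ≤ 96 * d.α * d.bumpMass * (2 : ℝ) ^ j := d.integral_blockMajorant_le j

/-- **The distributional `L^∞` norm of the blocks**:
`‖Δ̇_j (𝓕 a₀)‖_{L^∞} ≤ 96 α m 2^j`. [folklore] -/
theorem eLpNormDistrib_lpBlock_datumDistrib_le (j : ℤ) :
    eLpNormDistrib ∞ (lpBlock j d.datumDistrib) ≤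
      ENNReal.ofReal (96 * d.α * d.bumpMass * (2 : ℝ) ^ j) := by
  rw [lpBlock_datumDistrib, ← MeasureTheory.Lp.toTemperedDistribution_toLp_eq (p := ∞)]
  refine (eLpNormDistrib_coe_le _).trans ?_
  rw [Lp.enorm_def, eLpNorm_congr_ae (SchwartzMap.coeFn_toLp _ _ _), eLpNorm_exponent_top]
  exact eLpNormEssSup_le_of_ae_bound (Eventually.of_forall (d.norm_blockSchwartz_le j))

/-- **The Bourgain–Pavlović datum is small in the largest critical space**:
`‖u₀‖_{Ḃ^{-1}_{∞,∞}} ≤ 96 α m` (`α = Q/√r`; Bourgain–Pavlović 2008, (3.3):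
`‖u₀‖_{Ḃ^{-1,∞}_∞} ∼ Q/√r < δ` "for appropriate `r`"), for the Littlewood–Paley norm
`Literature.Analysis.FunctionSpaces.eHomBesovNorm (-1) ∞ ∞` of the datum's tempered distribution. [cite: BourgainPavlovic2008, (3.3)] -/
theorem eHomBesovNorm_datumDistrib_le :
    eHomBesovNorm (-1) ∞ ∞ d.datumDistrib ≤ ENNReal.ofReal (96 * d.α * d.bumpMass) := by
  rw [eHomBesovNorm_top]
  refine iSup_le fun j => ?_
  have h2 : (2 : ℝ≥0∞) ^ ((j : ℝ) * (-1)) = ENNReal.ofReal ((2 : ℝ) ^ (-j)) := by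
    rw [show (2 : ℝ≥0∞) = ENNReal.ofReal 2 by norm_num,
      ENNReal.ofReal_rpow_of_pos two_pos, mul_neg_one, ← Real.rpow_intCast]
    push_cast
    ring_nf
  have hK : 0 ≤ 96 * d.α * d.bumpMass := by
    have := d.α_pos.le; have := d.bumpMass_nonneg; positivity
  calc (2 : ℝ≥0∞) ^ ((j : ℝ) * (-1)) * eLpNormDistrib ∞ (lpBlock j d.datumDistrib)
      ≤ ENNReal.ofReal ((2 : ℝ) ^ (-j)) * ENNReal.ofReal (96 * d.α * d.bumpMass * (2 : ℝ) ^ j) := by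
        rw [h2]; gcongr; exact d.eLpNormDistrib_lpBlock_datumDistrib_le j
    _ = ENNReal.ofReal (96 * d.α * d.bumpMass) := by
        rw [← ENNReal.ofReal_mul (zpow_nonneg zero_le_two _)]
        congr 1
        have h2ne : (2 : ℝ) ^ j ≠ 0 := zpow_ne_zero j two_ne_zero
        rw [zpow_neg]
        field_simp

end InflationParams

end Literature.Analysis.FluidPDE.BourgainPavlovic
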